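import Literature.AnabelianGeometry.AbsoluteAnabelian.AbsTopIII.KummerFaithfulNeronSectionsProofs
import Literature.AnabelianGeometry.AbsoluteAnabelian.AbsTopIII.KummerFaithfulDedekindSectionsProofs
import Mathlib.AlgebraicGeometry.Morphisms.Flat
import HarnessLib

/-!
# [AbsTopIII] Rmk. 1.5.4 (i), "restricting to closed points": reduction of sections at a field point

Proof-only companion (no new definitions) to `AbsTopIII/KummerFaithful.lean` (S. Mochizuki, *Topics in
Absolute Anabelian Geometry III*, §1, Def. 1.5 (a) p. 32, Rmk. 1.5.4 (i) p. 33, lit key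
`paper:url-5493eb38cbb7`).  Junction J-c (second half) and a field-point form of J-d of the route of
record for the last open part of FACT-LIST row F-0369 (HOME/staging/f/f-083/g2/F0369-FG-ROUTE.md).

REDUCTION.  For a scheme `X`, a group scheme `𝒩 → X` (an object of `Over X` with a group structure) and
a field point `φ : Spec K → X`, base change along `φ` (Mathlib `Over.pullback φ`, a monoidal functor)
turns a global section `s : X → 𝒩` into a `K`-point `red s` of the special fibre
`𝒩_φ := 𝒩 ×_X Spec K` — a group scheme over `K`, proper if `𝒩` is — and `s ↦ red s` is
MULTIPLICATIVE (`reduction_mul`, `reduction_one`, `reduction_pow`; Mathlib `Functor.map_mul`).  If two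
sections have the same reduction then they agree on the field point: `φ ≫ s = φ ≫ t`
(`comp_left_eq_of_reduction_eq`).  So a divisible section has divisible reductions
(`exists_pow_reduction_eq`), which over MLF residue fields are trivial
(`AlgPoints.eq_one_of_forall_exists_pow_eq_of_finite_padic`, companion
`KummerFaithfulProperGroupSchemePointsProofs`), whence `φ ≫ s.left = φ ≫ 1.left`.

FIELD-POINT FORM OF J-d.  `Spec.hom_ext_of_infinite_fieldPoints`: two morphisms `Spec A → Y` (`A`
Dedekind) over a separated `Y → Z` that agree on field points `Spec K_x → Spec A` through the points `x`
of an infinite set are equal — every field point factors through the residue-field point (Mathlib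
`descResidueField_stalkClosedPointTo_fromSpecResidueField`) by an epimorphism, so this is
`Spec.hom_ext_of_infinite_of_isSeparated` (companion `KummerFaithfulDedekindSectionsProofs`).

"By restricting to various closed points of this variety" (p. 33).  Nothing here bears on [IUTchIII]
Cor. 3.12; typed ≠ discharged.
-/

noncomputable section

open _root_.CategoryTheory _root_.CategoryTheory.Limits _root_.AlgebraicGeometry
open scoped _root_.CategoryTheory.MonObj _root_.CategoryTheory.Obj MonoidalCategory Classical

namespace Literature.AnabelianGeometry.AbsoluteAnabelian.AbsTopIII

universe u

open Literature.AlgebraicGeometry.Motives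

/-! ### Reduction of global sections at a field point -/

section Reduction

variable {X : Scheme.{u}} {𝒩 : Over X} [GrpObj 𝒩] {K : Type u} [Field K] (φ : Spec (.of K) ⟶ X)

omit [GrpObj 𝒩] in
/-- Two global sections of `𝒩 → X` with the same base change along a field point `φ : Spec K → X`
agree on that point: `φ ≫ s = φ ≫ t` as morphisms `Spec K → 𝒩` (the base change of a section `s`
is the pair `(φ^* s, id)`, whose first projection to `𝒩` over `Spec K ×_X X ≅ Spec K` is `φ ≫ s`).
Routine pull-back bookkeeping for [AbsTopIII] Rmk. 1.5.4 (i) p. 33.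
[cite: MochizukiAbsTopIII2015, Rmk 1.5.4 (i) p.33] -/
theorem comp_left_eq_of_pullback_map_eq (s t : 𝟙_ (Over X) ⟶ 𝒩)
    (h : (Over.pullback φ).map s = (Over.pullback φ).map t) : φ ≫ s.left = φ ≫ t.left := by
  have h1 : ∀ r : 𝟙_ (Over X) ⟶ 𝒩, ((Over.pullback φ).map r).left ≫ pullback.fst 𝒩.hom φ =
      pullback.fst (𝟙_ (Over X)).hom φ ≫ r.left := fun r => by
    change pullback.lift (pullback.fst _ _ ≫ r.left) (pullback.snd _ _) _ ≫ _ = _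
    rw [pullback.lift_fst]
  have h2 : pullback.fst (𝟙_ (Over X)).hom φ ≫ s.left = pullback.fst (𝟙_ (Over X)).hom φ ≫ t.left := by
    rw [← h1 s, ← h1 t, h]
  -- `pullback.fst (𝟙 X) φ = pullback.snd ≫ φ`, and `pullback.snd (𝟙 X) φ` is an isomorphism
  have h3 : pullback.fst (𝟙_ (Over X)).hom φ = pullback.snd (𝟙_ (Over X)).hom φ ≫ φ := by
    have := pullback.condition (f := (𝟙_ (Over X)).hom) (g := φ)
    change pullback.fst _ _ ≫ 𝟙 X = _ at this
    rwa [Category.comp_id] at this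
  haveI : IsIso (pullback.snd (𝟙_ (Over X)).hom φ) := by
    change IsIso (pullback.snd (𝟙 X) φ)
    infer_instance
  rw [h3] at h2
  erw [Category.assoc, Category.assoc] at h2
  exact (cancel_epi _).mp h2

/-- **The reduction of global sections at a field point is multiplicative**: for sections `s t` of a
group scheme `𝒩 → X` and a field point `φ : Spec K → X`, the `K`-points
`red r := (Spec K = 𝟙 ≅ φ^* 𝟙) ≫ φ^* r` of the special fibre `φ^* 𝒩` satisfy
`red (s · t) = red s · red t` (base change is a monoidal functor: Mathlib `Functor.map_mul`).  In
[AbsTopIII] Rmk. 1.5.4 (i) p. 33 this is "restricting [...] to closed points" as a GROUP homomorphism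
`𝒩(R) → 𝒩_x(κ(x))`. [cite: MochizukiAbsTopIII2015, Rmk 1.5.4 (i) p.33] -/
theorem reduction_mul (s t : 𝟙_ (Over X) ⟶ 𝒩) :
    (eqToHom (specOver_self_eq_tensorUnit K) ≫ (Functor.Monoidal.εIso (Over.pullback φ)).hom ≫
        (Over.pullback φ).map (s * t) : AlgPoints ((Over.pullback φ).obj 𝒩) K) =
      (eqToHom (specOver_self_eq_tensorUnit K) ≫ (Functor.Monoidal.εIso (Over.pullback φ)).hom ≫
          (Over.pullback φ).map s) *
        (eqToHom (specOver_self_eq_tensorUnit K) ≫ (Functor.Monoidal.εIso (Over.pullback φ)).hom ≫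
          (Over.pullback φ).map t) := by
  rw [Functor.map_mul, MonObj.comp_mul, MonObj.comp_mul]

/-- The reduction of the unit section is the identity point (`Functor.map_one`).
[cite: MochizukiAbsTopIII2015, Rmk 1.5.4 (i) p.33] -/
theorem reduction_one :
    (eqToHom (specOver_self_eq_tensorUnit K) ≫ (Functor.Monoidal.εIso (Over.pullback φ)).hom ≫
        (Over.pullback φ).map (1 : 𝟙_ (Over X) ⟶ 𝒩) : AlgPoints ((Over.pullback φ).obj 𝒩) K) = 1 := by
  rw [Functor.map_one, MonObj.comp_one, MonObj.comp_one]

/-- The reduction of sections commutes with powers. [cite: MochizukiAbsTopIII2015, Rmk 1.5.4 (i) p.33] -/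
theorem reduction_pow (s : 𝟙_ (Over X) ⟶ 𝒩) (n : ℕ) :
    (eqToHom (specOver_self_eq_tensorUnit K) ≫ (Functor.Monoidal.εIso (Over.pullback φ)).hom ≫
        (Over.pullback φ).map (s ^ n) : AlgPoints ((Over.pullback φ).obj 𝒩) K) =
      (eqToHom (specOver_self_eq_tensorUnit K) ≫ (Functor.Monoidal.εIso (Over.pullback φ)).hom ≫
        (Over.pullback φ).map s) ^ n := by
  induction n with
  | zero => rw [pow_zero, pow_zero, reduction_one]
  | succ n ih => rw [pow_succ, reduction_mul, ih, pow_succ]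

/-- **A divisible section has divisible reductions**: if `s` admits an `n`-th root among the global
sections for every `n ≥ 1`, so does its reduction at any field point, in the group of `K`-points of
the special fibre. [cite: MochizukiAbsTopIII2015, Rmk 1.5.4 (i) p.33] -/
theorem exists_pow_reduction_eq (s : 𝟙_ (Over X) ⟶ 𝒩)
    (hs : ∀ n : ℕ, 0 < n → ∃ t : 𝟙_ (Over X) ⟶ 𝒩, t ^ n = s) (n : ℕ) (hn : 0 < n) :
    ∃ r : AlgPoints ((Over.pullback φ).obj 𝒩) K, r ^ n =
      eqToHom (specOver_self_eq_tensorUnit K) ≫ (Functor.Monoidal.εIso (Over.pullback φ)).hom ≫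
        (Over.pullback φ).map s := by
  obtain ⟨t, rfl⟩ := hs n hn
  exact ⟨_, (reduction_pow φ t n).symm⟩

/-- **If the reduction of a section at a field point is the identity, the section agrees with the unit
section on that point**: `red s = 1` implies `φ ≫ s = φ ≫ e` as morphisms `Spec K → 𝒩`
(`reduction_one`, `comp_left_eq_of_pullback_map_eq` after cancelling the isomorphisms).
[cite: MochizukiAbsTopIII2015, Rmk 1.5.4 (i) p.33] -/
theorem comp_left_eq_one_of_reduction_eq_one (s : 𝟙_ (Over X) ⟶ 𝒩)
    (h : (eqToHom (specOver_self_eq_tensorUnit K) ≫ (Functor.Monoidal.εIso (Over.pullback φ)).hom ≫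
        (Over.pullback φ).map s : AlgPoints ((Over.pullback φ).obj 𝒩) K) = 1) :
    φ ≫ s.left = φ ≫ (1 : 𝟙_ (Over X) ⟶ 𝒩).left := by
  apply comp_left_eq_of_pullback_map_eq
  rw [← reduction_one (𝒩 := 𝒩) φ] at h
  rw [cancel_epi, cancel_epi] at h
  exact h

omit [GrpObj 𝒩] in
/-- The special fibre of a proper `𝒩 → X` at a field point is proper over the field (base change;
Mathlib instance), recorded for the `Over.pullback` presentation used here.
[cite: MochizukiAbsTopIII2015, Rmk 1.5.4 (i) p.33] -/
theorem isProper_pullback_obj_hom [IsProper 𝒩.hom] : IsProper ((Over.pullback φ).obj 𝒩).hom := by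
  change IsProper (pullback.snd 𝒩.hom φ)
  infer_instance

end Reduction

/-! ### Field-point form of "sections agreeing at infinitely many points are equal" -/

section FieldPoints

variable {A : Type u} [CommRing A] [IsDedekindDomain A]

/-- `Spec` of a homomorphism between fields is an epimorphism of schemes (flat and surjective onto a
point; Mathlib `Flat.epi_of_flat_of_surjective`). Routine. [cite: MochizukiAbsTopIII2015, Rmk 1.5.4 (i) p.33] -/
theorem epi_specMap_of_isField {K₁ K₂ : CommRingCat.{u}} (h₁ : IsField K₁) (h₂ : IsField K₂)
    (f : K₁ ⟶ K₂) : Epi (Spec.map f) := by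
  have : Flat (Spec.map f) := HasRingHomProperty.Spec_iff.mpr (RingHom.Flat.of_isField h₁ _)
  letI : Field K₁ := h₁.toField
  letI : Field K₂ := h₂.toField
  have : Surjective (Spec.map f) :=
    ⟨fun x ↦ ⟨(default : PrimeSpectrum K₂), Subsingleton.elim (α := PrimeSpectrum K₁) _ _⟩⟩
  exact Flat.epi_of_flat_of_surjective _

/-- **Morphisms out of `Spec` of a Dedekind domain agreeing on field points through infinitely many
points are equal** (over a separated target): if for every `x` in an infinite set of points of
`Spec A` there is a field point `φ : Spec K → Spec A` hitting `x` with `φ ≫ f = φ ≫ g`, then `f = g`.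
Each `φ` factors as `Spec K → Spec κ(x) → Spec A` (Mathlib
`descResidueField_stalkClosedPointTo_fromSpecResidueField`) with `Spec K → Spec κ(x)` an epimorphism,
so `f` and `g` agree on the residue-field points of the infinite set and
`Spec.hom_ext_of_infinite_of_isSeparated` applies. [cite: MochizukiAbsTopIII2015, Rmk 1.5.4 (i) p.33] -/
theorem Spec.hom_ext_of_infinite_fieldPoints {Y Z : Scheme.{u}} (f g : Spec (.of A) ⟶ Y)
    (i : Y ⟶ Z) [IsSeparated i] (hfg : f ≫ i = g ≫ i) (S : Set (Spec (.of A))) (hS : S.Infinite)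
    (H : ∀ x ∈ S, ∃ (K : Type u) (_ : Field K) (φ : Spec (.of K) ⟶ Spec (.of A)),
      φ (IsLocalRing.closedPoint K) = x ∧ φ ≫ f = φ ≫ g) : f = g := by
  refine Spec.hom_ext_of_infinite_of_isSeparated f g i hfg S hS fun x hx => ?_
  obtain ⟨K, _, φ, hφx, hφ⟩ := H x hx
  subst hφx
  have hfac := Scheme.descResidueField_stalkClosedPointTo_fromSpecResidueField K (Spec (.of A)) φ
  haveI : Epi (Spec.map (Scheme.descResidueField (Scheme.stalkClosedPointTo φ))) :=
    epi_specMap_of_isField (Field.toIsField _) (Field.toIsField K) _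
  rw [← cancel_epi (Spec.map (Scheme.descResidueField (Scheme.stalkClosedPointTo φ))),
    ← Category.assoc, ← Category.assoc, hfac]
  exact hφ

/-- The case of two sections of a separated `Y → Spec A`. [cite: MochizukiAbsTopIII2015, Rmk 1.5.4 (i) p.33] -/
theorem Spec.sections_ext_of_infinite_fieldPoints {Y : Scheme.{u}} (q : Y ⟶ Spec (.of A))
    [IsSeparated q] (s t : Spec (.of A) ⟶ Y) (hs : s ≫ q = 𝟙 _) (ht : t ≫ q = 𝟙 _)
    (S : Set (Spec (.of A))) (hS : S.Infinite)
    (H : ∀ x ∈ S, ∃ (K : Type u) (_ : Field K) (φ : Spec (.of K) ⟶ Spec (.of A)),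
      φ (IsLocalRing.closedPoint K) = x ∧ φ ≫ s = φ ≫ t) : s = t :=
  Spec.hom_ext_of_infinite_fieldPoints s t q (by rw [hs, ht]) S hS H

end FieldPoints

end Literature.AnabelianGeometry.AbsoluteAnabelian.AbsTopIII
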